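import Summits.BirchSwinnertonDyer.Rank1Residual.Supersingular.X6VisibilityTamDefectShape
import HarnessLib

/-!
# N4 TAM-DEFECT by VISIBILITY — RECORDS B: `BSD(E,5)` for `492414f1` (X6, `r_an = 0`, `#Ш_an = 25`, `5 ∣ ∏c_ℓ`) from a
# `5`-congruent rank-`2` curve of conductor `12310350 = 5²·492414` OUTSIDE Cremona's range, found in Fisher's Hesse pencil
# `X_E(5)` at `(λ:μ) = (−2944975:1)`; Wuthrich's upper bound, Cassels–Tate and the THREE-kind refined count

Cell `b2b-bsdres`, supersingular family, prover A = unit `b2b-bsdres-x10b` (gen 15), N4 class lead.  Topic file;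
namespace `Summit.BirchSwinnertonDyer.Rank1Residual.Supersingular`.  THEOREMS ONLY; no named fact, no definition,
nothing booked; X6 stays CONSTRUCTION-SHAPED (mark of RESIDUAL-MAP §I N4 unchanged).  Shape and the account of the
method: `X6VisibilityTamDefectShape.lean` (module docstring); first record (22678e1 ← 430882i1): `X6VisibilityTamDefectRecords.lean`.
Here the partner is NOT in any table: the five-kind Hesse-pencil scan `HOME/b2b-bsdres-x10b/gen15/code/hesse_scan_x6.gp`
(x11a gen-11 `hesse5_search.gp` family/covariant code byte-identical + a place analyser) over `μ ≤ 3`, `|λ| ≤ 1.2·10⁷`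
(kit j154655) returned, as its top candidate (new-prime cofactor of `𝔇(λ,1)` equal to `1`), the member `(−2944975 : 1)` whose
minimal model `F = [1,1,1,−203276888,1060005312281]` has conductor `2·3·5²·13·59·107` (ADDITIVE at `5`, multiplicative
elsewhere), `ellrank(F) = [2,2]` with points `(14261, 1023245)`, `(5939, 246563)` independent in `F(ℚ)/5F(ℚ)` (reduction
functionals at 17, 23).  §1 adds the THREE-kind form of the shape (no Fisher 2016 binder: no place of kind (iv) occurs here).

HONEST FRAMING (run/shared/lean/b2b/bsd-rank1-residual/, verbatim in every file): the goal of the cell is to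
DELETE the COMBINATION-SHAPED residual classes of the Birch–Swinnerton-Dyer formula for ALL analytic-rank `≤ 1`
elliptic curves over `ℚ` — "full BSD formula for every rank `≤ 1` curve in class `C`" assembled STRICTLY from
published theorems — so that the rank-`≤ 1` remainder becomes exactly the CONSTRUCTION-SHAPED classes, which are
TYPED (missing-input `Prop`s), NOT attempted.  This is not "finishing BSD".

References: Cremona–Mazur 2000 §3 [CremonaMazur2000]; Fisher 2016 Thm. 4.4 [Fisher2016Visualizing7]; Fisher 2012
Thm. 13.2 [Fisher2012Hessian]; Wuthrich 2014 Prop. 21 [Wuthrich2014]; Silverman AEC VII.5.1, X.4.14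
[SilvermanAEC2009]; ATAEC V [SilvermanATAEC1994]; Cremona's tables [Cremona2006]; HOME/b2b-bsdres-x10b/X6-KURIHARA.md §18.
-/

set_option autoImplicit false

noncomputable section

open scoped Classical

open WeierstrassCurve Literature.NumberTheory.EllipticCurves
  Literature.NumberTheory.EllipticCurves.Rank1Residual
  Literature.NumberTheory.EllipticCurves.Rank1Residual.Typed
  Literature.NumberTheory.EllipticCurves.Rank1Residual.X11RankOneCertificates
  Literature.NumberTheory.EllipticCurves.Wuthrich2014
  Literature.NumberTheory.EllipticCurves.Fisher2016
  Literature.NumberTheory.EllipticCurves.Fisher2012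
  Summit.BirchSwinnertonDyer.BirchSwinnertonDyer.Rank1Residual.IntModel
  Summit.BirchSwinnertonDyer.Rank1Residual.X11b
open NumberField IsDedekindDomain Rat.HeightOneSpectrum

namespace Summit.BirchSwinnertonDyer.Rank1Residual.Supersingular

/-! ### §1. The THREE-kind form of the shape (kinds (i)–(iii); no Fisher 2016 Thm. 4.4 binder) -/

/-- **X6 ∩ {r_an = 0}, odd `p`, `ord_p #Ш_an ≤ 2`: `BSD(E,p)` from PUBLISHED theorems plus a `p`-CONGRUENT curve `W'`
with the THREE-kind refined visibility count** (pay at `T ⊆ S`; kinds (i) `v ∤ p`, `W'(ℚ_v)[p] = 0`, (ii) both split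
multiplicative with `#W(ℚ_v)[p] ≤ p`, (iii) both multiplicative of the same `γ`-class with `μ_p(ℚ_v) = 1`; the tree's
`exists_sha_ne_zero_of_congr_of_places`, x11a gen 10).  Same chain as `X6RankZero.bsdp_of_casselsTate_of_congr_of_places₄`
(Cassels–Tate squareness + Wuthrich Prop. 21, NO Tamagawa hypothesis) without the Fisher 2016 input.  Per pair; NOT a
class theorem. [cite: Wuthrich2014, Prop. 21 (p. 400)] [cite: CremonaMazur2000, §3 and Table 1]
[cite: SilvermanATAEC1994, Ch. V Thm. 3.1, Lemma 5.2, Thm. 5.3, Cor. 5.4] [cite: SilvermanAEC2009, Thm. X.4.14] -/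
theorem X6RankZero.bsdp_of_casselsTate_of_congr_of_places
    (hCT : exists_casselsTate_pairing (K := ℚ)) (hW : sha_dvd_analyticSha)
    (hGZK : rank_eq_analyticRank_of_analyticRank_le_one) (hmod : hasEntireLFunction_rat)
    (hU : Silverman1994_thmV53_tateUniformisation.{0})
    (hU2 : Silverman1994_thmV53_corV54_tateUniformisation.{0})
    (W : WeierstrassCurve ℚ) [W.IsElliptic] [W.IsGloballyMinimal] (p : ℕ) [Fact p.Prime] (hp : p ≠ 2)
    (hX : ClassX6 W p) (hr : W.analyticRank = 0) {q : ℚ} (hq : shaAn W = (q : ℂ)) (hv : padicValRat p q ≤ 2)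
    (W' : WeierstrassCurve ℚ) [W'.IsElliptic]
    (θ : geomTorsion W' (p : ℤ) ≃+ geomTorsion W (p : ℤ))
    (hθ : ∀ (σ : Field.absoluteGaloisGroup ℚ) (P : geomTorsion W' (p : ℤ)), θ (σ • P) = σ • θ P)
    (S T : Finset (HeightOneSpectrum (𝓞 ℚ))) (hTS : T ⊆ S)
    (hS : ∀ w : HeightOneSpectrum (𝓞 ℚ), w ∉ S →
      W.HasGoodReductionAt w ∧ W'.HasGoodReductionAt w ∧ (p : 𝓞 ℚ) ∉ w.asIdeal)
    (hT : (∏ w ∈ T, Nat.card (nsmulAddMonoidHom p :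
        (W'.baseChange (w.adicCompletion ℚ)).toAffine.Point →+ _).ker *
        Nat.card (w.adicCompletionIntegers ℚ ⧸
          Ideal.span {(p : w.adicCompletionIntegers ℚ)})) < p ^ W'.mordellWeilRank)
    (hplaces : ∀ w ∈ S, w ∉ T →
      ((p : 𝓞 ℚ) ∉ w.asIdeal ∧ Nat.card (nsmulAddMonoidHom p :
          (W'.baseChange (w.adicCompletion ℚ)).toAffine.Point →+ _).ker = 1) ∨
      (W.HasSplitMultiplicativeReductionAt w ∧ W'.HasSplitMultiplicativeReductionAt w ∧
        Nat.card (nsmulAddMonoidHom p :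
          (W.baseChange (w.adicCompletion ℚ)).toAffine.Point →+ _).ker ≤ p) ∨
      (W.HasMultiplicativeReductionAt w ∧ W'.HasMultiplicativeReductionAt w ∧
        (∃ r : w.adicCompletion ℚ, algebraMap ℚ (w.adicCompletion ℚ) (-(W.c₄ / W.c₆)) =
          r ^ 2 * algebraMap ℚ (w.adicCompletion ℚ) (-(W'.c₄ / W'.c₆))) ∧
        (∀ ζ : w.adicCompletion ℚ, ζ ^ p = 1 → ζ = 1))) :
    BSDp W p := by
  haveI hfin : Finite W.toAffine.Point := finite_point_of_analyticRank_eq_zero W hGZK hr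
  have hirr : Irr W p := ClassX6.irr W p hp hX
  have hcop : (Nat.card W.toAffine.Point).Coprime p := coprime_natCard_point_of_irr W p hirr
  have hex : ∃ c : W.sha, c ≠ 0 ∧ p • c = 0 :=
    W.exists_sha_ne_zero_of_congr_of_places hU hU2 hp W' θ hθ S T hTS hS hfin hcop hT hplaces
  have hfinSha : W.ShaFinite := (hGZK W (by rw [hr]; norm_num)).2
  have hlow : MissingLowerBoundAt W p :=
    missingLowerBoundAt_of_casselsTate_of_pow_dvd W p hCT hfinSha hq (k := 1) (by simpa using hv)
      (by simpa using dvd_shaOrder_of_exists_torsion W p hex)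
  exact X6.bsdp_of_missingLowerBoundAt_of_analyticRank_eq_zero W p hW hGZK hmod hp hX hr hlow

/-! ### §2. The record: `BSD(E,5)` for `492414f1` from the `5`-congruent rank-`2` curve of conductor `12310350` -/

/-- `492414f1` (Cremona's minimal model) is an elliptic curve: `Δ ≠ 0`. [cite: Cremona2006, Table 1 (Cremona label 492414f1)] -/
theorem isElliptic_c492414f1 : (⟨1, 1, 1, -174686782448, -28102134435119791⟩ : WeierstrassCurve ℚ).IsElliptic :=
  isElliptic_of_discOf_ne_zero 1 1 1 (-174686782448) (-28102134435119791) (by decide +kernel)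

/-- `492414f1` is globally minimal (Kraus' bounded criterion, kernel). [cite: SilvermanAEC2009, VII.1 Remark 1.1] -/
theorem isGloballyMinimal_c492414f1 :
    (⟨1, 1, 1, -174686782448, -28102134435119791⟩ : WeierstrassCurve ℚ).IsGloballyMinimal :=
  isGloballyMinimal_of_krausCriterion_bounded₂ 1 1 1 (-174686782448) (-28102134435119791) (by decide +kernel)
    (by decide +kernel) (by decide +kernel)

/-- The partner `F = [1,1,1,−203276888,1060005312281]` (the minimal model of the member `(−2944975:1)` of the Hesse pencil of
`492414f1`; conductor `12310350`) is an elliptic curve: `Δ = 2^10·3^3·5^10·13·59^4·107^3 ≠ 0`.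
[cite: Fisher2012Hessian, Thm. 13.2 (a member of the Hesse pencil, minimal model)] -/
theorem isElliptic_f12310350 : (⟨1, 1, 1, -203276888, 1060005312281⟩ : WeierstrassCurve ℚ).IsElliptic :=
  isElliptic_of_discOf_ne_zero 1 1 1 (-203276888) 1060005312281 (by decide +kernel)

/-- The partner `F` is globally minimal (Kraus' bounded criterion, kernel). [cite: SilvermanAEC2009, VII.1 Remark 1.1] -/
theorem isGloballyMinimal_f12310350 : (⟨1, 1, 1, -203276888, 1060005312281⟩ : WeierstrassCurve ℚ).IsGloballyMinimal :=
  isGloballyMinimal_of_krausCriterion_bounded₂ 1 1 1 (-203276888) 1060005312281 (by decide +kernel) (by decide +kernel)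
    (by decide +kernel)

/-- `#Ẽ(𝔽₅) = 6` for `492414f1` (`a₅ = 0`: good SUPERSINGULAR at `5`; kernel count). [folklore] -/
theorem card_c492414f1_5 :
    Nat.card (((⟨1, 1, 1, -174686782448, -28102134435119791⟩ : WeierstrassCurve ℤ).map
      (Int.castRingHom (ZMod 5))).toAffine.Point) = 6 :=
  haveI : Fact (Nat.Prime 5) := ⟨by norm_num⟩
  natCard_point_eq_of_countPoints 1 1 1 (-174686782448) (-28102134435119791) 5 (by norm_num) (by decide +kernel)
    (by decide +kernel)

/-- **`BSD(E,5)` for `492414f1`, congruence as a displayed binder** (N4 TAM-DEFECT cell: class X6,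
`N = 492414 = 2·3·13·59·107`, good supersingular at `5` (`a₅ = 0`), `r_an = 0`, `#E(ℚ)_tors = 2`, `∏c_ℓ = 80`
(`c₂ = 20`: `5 ∣ ∏c`; Kim's route needs a two-prime depth-2 level ≈ 4.7e11 series terms), `#Ш_an = 25`) from PUBLISHED
theorems — Cassels–Tate (`hCT`), Wuthrich 2014 Prop. 21 (`hW`; NO Tamagawa hypothesis), GZK (`hGZK`), modularity (`hmod`),
Tate uniformisation (`hU`, `hU2`) — and a VISIBLE element of `Ш(E)[5]` explained by the `5`-CONGRUENT RANK-`2` curve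
`F = [1,1,1,−203276888,1060005312281]` of conductor `12310350 = 2·3·5²·13·59·107` (additive at `5`, multiplicative elsewhere;
`Δ_F = 2^10·3^3·5^10·13·59^4·107^3`; points `(14261, 1023245)`, `(5939, 246563)`), NOT in any table (found in Fisher's Hesse
pencil `X_E(5)` at `(λ:μ) = (−2944975:1)`, kit j154655).  KERNEL: minimality of both models, `ClassX6 E 5`, good reduction of
both off `{2,3,5,13,59,107}` (discriminant supports `|Δ_E| = 2^20·3^28·13·59·107²` and `Δ_F`), of `E` at `5`, multiplicative
reduction of `E` and `F` at `2` and `59`, `5 ∤ #E(ℚ)`.  DISPLAYED BINDERS (evidence HOME/b2b-bsdres-x10b/gen15/: PARI kit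
j154655 + pure-python `cert492414.py`/`tors5local.py`): `θ : F[5] ≅ E[5]` (`hθ` — in THIS form; the KERNEL form is
`bsdp_x6r0vis_492414f1_5` below); `rank F(ℚ) ≥ 2` (`hrank`; 2-descent `ellrank = [2,2]`, independence of the two points in
`F(ℚ)/5F(ℚ)` by reduction functionals at 17, 23, matrix `[[1,0],[2,1]]` of rank 2 mod 5); `#F(ℚ_v)[5] = 1` at the places over
`5` (additive), `3`, `13`, `107` (non-split, `ℓ ≢ −1 (mod 5)`) (`h5`, `h3`, `h13`, `h107`); at the places over `2` (both SPLIT)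
and `59` (both NON-split): `γ(E) = r²γ(F)` in `ℚ_v` and `μ₅(ℚ_v) = 1` (`h2`, `h59`); the Cremona data `r_an(E) = 0`,
`ord₅ #Ш_an(E) ≤ 2`.  The count: pay `5·#F(ℚ₅)[5] = 5 < 25 ≤ 5^{rank F}` at `5`; `2`, `59` free of kind (iii); `3`, `13`,
`107` free of kind (i).  Per pair (an OFFER for referee A); NOT a class theorem; nothing booked.
[cite: Wuthrich2014, Prop. 21 (p. 400)] [cite: CremonaMazur2000, §3 and Table 1] [cite: SilvermanAEC2009, VII.5 Prop. 5.1 and Thm. X.4.14]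
[cite: SilvermanATAEC1994, Ch. V Thm. 3.1, Lemma 5.2, Thm. 5.3, Cor. 5.4] [cite: Cremona2006, Table 1 (Cremona label 492414f1)] -/
theorem bsdp_x6r0vis_492414f1_5_of_congr
    (hCT : exists_casselsTate_pairing (K := ℚ)) (hW : sha_dvd_analyticSha)
    (hGZK : rank_eq_analyticRank_of_analyticRank_le_one) (hmod : hasEntireLFunction_rat)
    (hU : Silverman1994_thmV53_tateUniformisation.{0})
    (hU2 : Silverman1994_thmV53_corV54_tateUniformisation.{0})
    {W F : WeierstrassCurve ℚ} [W.IsElliptic] [W.IsGloballyMinimal] [F.IsElliptic] [F.IsGloballyMinimal]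
    (hWeq : W = ⟨1, 1, 1, -174686782448, -28102134435119791⟩) (hFeq : F = ⟨1, 1, 1, -203276888, 1060005312281⟩)
    (hr0 : W.analyticRank = 0) {q : ℚ} (hq : shaAn W = (q : ℂ)) (hv : padicValRat 5 q ≤ 2)
    (θ : geomTorsion F (5 : ℤ) ≃+ geomTorsion W (5 : ℤ))
    (hθ : ∀ (σ : Field.absoluteGaloisGroup ℚ) (P : geomTorsion F (5 : ℤ)), θ (σ • P) = σ • θ P)
    (hrank : 2 ≤ F.mordellWeilRank)
    (h5 : ∀ w : HeightOneSpectrum (𝓞 ℚ), (primesEquiv w : ℕ) = 5 →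
      Nat.card (nsmulAddMonoidHom 5 : (F.baseChange (w.adicCompletion ℚ)).toAffine.Point →+ _).ker = 1)
    (h3 : ∀ w : HeightOneSpectrum (𝓞 ℚ), (primesEquiv w : ℕ) = 3 →
      Nat.card (nsmulAddMonoidHom 5 : (F.baseChange (w.adicCompletion ℚ)).toAffine.Point →+ _).ker = 1)
    (h13 : ∀ w : HeightOneSpectrum (𝓞 ℚ), (primesEquiv w : ℕ) = 13 →
      Nat.card (nsmulAddMonoidHom 5 : (F.baseChange (w.adicCompletion ℚ)).toAffine.Point →+ _).ker = 1)
    (h107 : ∀ w : HeightOneSpectrum (𝓞 ℚ), (primesEquiv w : ℕ) = 107 →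
      Nat.card (nsmulAddMonoidHom 5 : (F.baseChange (w.adicCompletion ℚ)).toAffine.Point →+ _).ker = 1)
    (h2 : ∀ w : HeightOneSpectrum (𝓞 ℚ), (primesEquiv w : ℕ) = 2 →
      (∃ r : w.adicCompletion ℚ, algebraMap ℚ (w.adicCompletion ℚ) (-(W.c₄ / W.c₆)) =
          r ^ 2 * algebraMap ℚ (w.adicCompletion ℚ) (-(F.c₄ / F.c₆))) ∧
        (∀ ζ : w.adicCompletion ℚ, ζ ^ 5 = 1 → ζ = 1))
    (h59 : ∀ w : HeightOneSpectrum (𝓞 ℚ), (primesEquiv w : ℕ) = 59 →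
      (∃ r : w.adicCompletion ℚ, algebraMap ℚ (w.adicCompletion ℚ) (-(W.c₄ / W.c₆)) =
          r ^ 2 * algebraMap ℚ (w.adicCompletion ℚ) (-(F.c₄ / F.c₆))) ∧
        (∀ ζ : w.adicCompletion ℚ, ζ ^ 5 = 1 → ζ = 1)) :
    BSDp W 5 := by
  haveI : Fact (Nat.Prime 5) := ⟨by norm_num⟩
  have hIW : integralModelInt W = ⟨1, 1, 1, -174686782448, -28102134435119791⟩ :=
    integralModelInt_eq_of_map_eq _ (by rw [hWeq]; ext <;> simp [WeierstrassCurve.map])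
  have hIF : integralModelInt F = ⟨1, 1, 1, -203276888, 1060005312281⟩ :=
    integralModelInt_eq_of_map_eq _ (by rw [hFeq]; ext <;> simp [WeierstrassCurve.map])
  -- class X6 at 5 for the target
  have hX : ClassX6 W 5 :=
    classX6_of_intModel 5 le_rfl hIW (by decide +kernel) card_c492414f1_5 (by decide) (by decide +kernel)
  -- the prime lists: every prime divisor of Δ_E, Δ_F lies in L
  set L : List ℕ := [2, 3, 5, 13, 59, 107] with hL
  have hLp : ∀ q ∈ L, q.Prime := by decide
  have hΔE : ∀ q : ℕ, q.Prime → (q : ℤ) ∣ (⟨1, 1, 1, -174686782448, -28102134435119791⟩ : WeierstrassCurve ℤ).Δ →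
      q ∈ L :=
    forall_mem_of_natAbs_eq_prod_pow L [20, 28, 0, 1, 1, 2] hLp (by decide +kernel)
  have hΔF : ∀ q : ℕ, q.Prime → (q : ℤ) ∣ (⟨1, 1, 1, -203276888, 1060005312281⟩ : WeierstrassCurve ℤ).Δ → q ∈ L :=
    forall_mem_of_natAbs_eq_prod_pow L [10, 3, 10, 1, 4, 3] hLp (by decide +kernel)
  -- the sets of places S (over L) and T (over 5)
  set e := primesEquiv (R := 𝓞 ℚ) with he
  set v₅ : HeightOneSpectrum (𝓞 ℚ) := e.symm ⟨5, Fact.out⟩ with hv₅def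
  have hv₅ : (e v₅ : ℕ) = 5 := by rw [hv₅def, Equiv.apply_symm_apply]
  have heq5 : ∀ w : HeightOneSpectrum (𝓞 ℚ), (e w : ℕ) = 5 → w = v₅ := by
    intro w hw
    have h1 : e w = ⟨5, Fact.out⟩ := Subtype.ext hw
    rw [hv₅def, ← h1, Equiv.symm_apply_apply]
  set S : Finset (HeightOneSpectrum (𝓞 ℚ)) :=
    (L.filterMap fun r ↦ if h : r.Prime then some (e.symm ⟨r, h⟩) else none).toFinset with hSdef
  have hmemS : ∀ w : HeightOneSpectrum (𝓞 ℚ), w ∈ S ↔ (e w : ℕ) ∈ L := by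
    intro w
    rw [hSdef, List.mem_toFinset, List.mem_filterMap]
    constructor
    · rintro ⟨r, hr, hrw⟩
      by_cases hrp : r.Prime
      · rw [dif_pos hrp, Option.some.injEq] at hrw
        rw [← hrw, Equiv.apply_symm_apply]
        exact hr
      · rw [dif_neg hrp] at hrw
        exact absurd hrw (by simp)
    · intro hw
      refine ⟨(e w : ℕ), hw, ?_⟩
      rw [dif_pos (e w).2]
      simp
  set T : Finset (HeightOneSpectrum (𝓞 ℚ)) := {v₅} with hTdef
  have hTS : T ⊆ S := by
    intro w hw
    rw [hTdef, Finset.mem_singleton] at hw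
    rw [hmemS, hw, hv₅]; decide
  -- good reduction outside S
  have hS : ∀ w : HeightOneSpectrum (𝓞 ℚ), w ∉ S →
      W.HasGoodReductionAt w ∧ F.HasGoodReductionAt w ∧ ((5 : ℕ) : 𝓞 ℚ) ∉ w.asIdeal := by
    intro w hwS
    have hwL : (e w : ℕ) ∉ L := fun h ↦ hwS ((hmemS w).mpr h)
    have hq : (e w : ℕ).Prime := (e w).2
    refine ⟨?_, ?_, natCast_not_mem_of_primesEquiv_ne w Fact.out fun h ↦ hwL ?_⟩
    · rw [hWeq]; exact hasGoodReductionAt_mk_of_primesEquiv _ _ _ _ _ w rfl fun h ↦ hwL (hΔE _ hq h)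
    · rw [hFeq]; exact hasGoodReductionAt_mk_of_primesEquiv _ _ _ _ _ w rfl fun h ↦ hwL (hΔF _ hq h)
    · show (primesEquiv w : ℕ) ∈ L
      rw [h]; decide
  -- the paid place 5: `#F(ℚ₅)[5] · #(ℤ₅/5) = 1 · 5 < 25 ≤ 5 ^ rank F`
  have hcard5 : ∏ w ∈ T, Nat.card (w.adicCompletionIntegers ℚ ⧸
      Ideal.span {((5 : ℕ) : w.adicCompletionIntegers ℚ)}) = 5 ^ Module.finrank ℚ ℚ :=
    WeierstrassCurve.prod_natCard_quot_adicCompletionIntegers (K := ℚ) (p := 5) T fun w hw h ↦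
      hw (by rw [hTdef, Finset.mem_singleton]; exact heq5 w (primesEquiv_eq_of_natCast_mem Fact.out h))
  have hT : (∏ w ∈ T, Nat.card (nsmulAddMonoidHom 5 :
        (F.baseChange (w.adicCompletion ℚ)).toAffine.Point →+ _).ker *
        Nat.card (w.adicCompletionIntegers ℚ ⧸
          Ideal.span {((5 : ℕ) : w.adicCompletionIntegers ℚ)})) < 5 ^ F.mordellWeilRank := by
    rw [Finset.prod_mul_distrib, hcard5, Module.finrank_self, hTdef, Finset.prod_singleton, h5 v₅ hv₅]
    calc (1 : ℕ) * 5 ^ 1 < 5 ^ 2 := by norm_num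
      _ ≤ 5 ^ F.mordellWeilRank := Nat.pow_le_pow_right (by norm_num) hrank
  -- the free places (kinds (i) and (iii) only)
  have hplaces : ∀ w ∈ S, w ∉ T →
      (((5 : ℕ) : 𝓞 ℚ) ∉ w.asIdeal ∧ Nat.card (nsmulAddMonoidHom 5 :
          (F.baseChange (w.adicCompletion ℚ)).toAffine.Point →+ _).ker = 1) ∨
      (W.HasSplitMultiplicativeReductionAt w ∧ F.HasSplitMultiplicativeReductionAt w ∧
        Nat.card (nsmulAddMonoidHom 5 :
          (W.baseChange (w.adicCompletion ℚ)).toAffine.Point →+ _).ker ≤ 5) ∨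
      (W.HasMultiplicativeReductionAt w ∧ F.HasMultiplicativeReductionAt w ∧
        (∃ r : w.adicCompletion ℚ, algebraMap ℚ (w.adicCompletion ℚ) (-(W.c₄ / W.c₆)) =
          r ^ 2 * algebraMap ℚ (w.adicCompletion ℚ) (-(F.c₄ / F.c₆))) ∧
        (∀ ζ : w.adicCompletion ℚ, ζ ^ 5 = 1 → ζ = 1)) := by
    intro w hwS hwT
    have hwL : (e w : ℕ) ∈ L := (hmemS w).mp hwS
    have hw5 : (e w : ℕ) ≠ 5 := fun h ↦ hwT (by rw [hTdef, Finset.mem_singleton]; exact heq5 w h)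
    have hcases : (e w : ℕ) = 2 ∨ (e w : ℕ) = 3 ∨ (e w : ℕ) = 13 ∨ (e w : ℕ) = 59 ∨ (e w : ℕ) = 107 := by
      simp only [hL, List.mem_cons, List.mem_nil_iff, or_false] at hwL
      omega
    rcases hcases with hw | hw | hw | hw | hw
    · -- 2: both multiplicative (kernel), same γ-class and μ₅(ℚ₂) = 1 (binders)
      exact Or.inr (Or.inr ⟨hasMultiplicativeReductionAt_of_intModel_of_primesEquiv hIW w hw
        (by decide +kernel) (by decide +kernel), hasMultiplicativeReductionAt_of_intModel_of_primesEquiv hIF w hw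
        (by decide +kernel) (by decide +kernel), h2 w hw⟩)
    · -- 3: kind (i)
      exact Or.inl ⟨natCast_not_mem_of_primesEquiv_ne w Fact.out hw5, h3 w hw⟩
    · -- 13: kind (i)
      exact Or.inl ⟨natCast_not_mem_of_primesEquiv_ne w Fact.out hw5, h13 w hw⟩
    · -- 59: both multiplicative (kernel), same γ-class and μ₅(ℚ₅₉) = 1 (binders)
      exact Or.inr (Or.inr ⟨hasMultiplicativeReductionAt_of_intModel_of_primesEquiv hIW w hw
        (by decide +kernel) (by decide +kernel), hasMultiplicativeReductionAt_of_intModel_of_primesEquiv hIF w hw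
        (by decide +kernel) (by decide +kernel), h59 w hw⟩)
    · -- 107: kind (i)
      exact Or.inl ⟨natCast_not_mem_of_primesEquiv_ne w Fact.out hw5, h107 w hw⟩
  exact X6RankZero.bsdp_of_casselsTate_of_congr_of_places hCT hW hGZK hmod hU hU2 W 5 (by norm_num) hX hr0 hq hv F θ hθ
    S T hTS hS hT hplaces

/-! ### §3. The `5`-congruence IN THE KERNEL: `F` is the member `(λ : μ) = (−2944975 : 1)` of Fisher's Hesse pencil
`X_E(5)` of `492414f1` (Fisher 2012 Thm. 13.2; kit j154655 found it; the kernel re-verifies the two identities) -/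

/-- **`BSD(E,5)` for `492414f1` with the `5`-congruence PROVED in the kernel** (modulo the named fact Fisher 2012
Thm. 13.2 `hF13`): `F = [1,1,1,−203276888,1060005312281]` is ℚ-isomorphic to the member `E_{λ,μ}` of the Hesse pencil of
`E = 492414f1` at `(λ : μ) = (−2944975 : 1)` — the two covariant identities `𝔠₄(λ,μ) = u⁴·c₄(F)`, `𝔠₆(λ,μ) = u⁶·c₆(F)` with
`u = 145833440533279195958083584`, `c₄(E) = 8384965557505`, `c₆(E) = 24280181264701817983`, `c₄(F) = 9757290625`,
`c₆(F) = −915917769490625` are checked by `norm_num` on the closed forms `eval_hesseC4` / `eval_hesseC6` (x11a / eng-2), and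
`fiveCongruent_of_hesseCertificate` turns them into a `Γ_ℚ`-isomorphism `θ : F[5] ≅ E[5]` (two engines found/confirmed
`(λ, u)`: PARI kit j154655 and the pure-python `cert492414.py` on x11a's `engine2.py` Hesse polynomials).  Remaining displayed
binders: exactly those of `bsdp_x6r0vis_492414f1_5_of_congr` minus `θ`, `hθ`.  Per pair (an OFFER for referee A); NOT a
class theorem; nothing booked.
[cite: Fisher2012Hessian, Thm. 13.2] [cite: Wuthrich2014, Prop. 21 (p. 400)] [cite: CremonaMazur2000, §3 and Table 1]
[cite: Cremona2006, Table 1 (Cremona label 492414f1)] -/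
theorem bsdp_x6r0vis_492414f1_5
    (hCT : exists_casselsTate_pairing (K := ℚ)) (hW : sha_dvd_analyticSha)
    (hGZK : rank_eq_analyticRank_of_analyticRank_le_one) (hmod : hasEntireLFunction_rat)
    (hU : Silverman1994_thmV53_tateUniformisation.{0})
    (hU2 : Silverman1994_thmV53_corV54_tateUniformisation.{0}) (hF13 : thm132_fiveCongruent_hessePencil)
    {W F : WeierstrassCurve ℚ} [W.IsElliptic] [W.IsGloballyMinimal] [F.IsElliptic] [F.IsGloballyMinimal]
    (hWeq : W = ⟨1, 1, 1, -174686782448, -28102134435119791⟩) (hFeq : F = ⟨1, 1, 1, -203276888, 1060005312281⟩)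
    (hr0 : W.analyticRank = 0) {q : ℚ} (hq : shaAn W = (q : ℂ)) (hv : padicValRat 5 q ≤ 2)
    (hrank : 2 ≤ F.mordellWeilRank)
    (h5 : ∀ w : HeightOneSpectrum (𝓞 ℚ), (primesEquiv w : ℕ) = 5 →
      Nat.card (nsmulAddMonoidHom 5 : (F.baseChange (w.adicCompletion ℚ)).toAffine.Point →+ _).ker = 1)
    (h3 : ∀ w : HeightOneSpectrum (𝓞 ℚ), (primesEquiv w : ℕ) = 3 →
      Nat.card (nsmulAddMonoidHom 5 : (F.baseChange (w.adicCompletion ℚ)).toAffine.Point →+ _).ker = 1)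
    (h13 : ∀ w : HeightOneSpectrum (𝓞 ℚ), (primesEquiv w : ℕ) = 13 →
      Nat.card (nsmulAddMonoidHom 5 : (F.baseChange (w.adicCompletion ℚ)).toAffine.Point →+ _).ker = 1)
    (h107 : ∀ w : HeightOneSpectrum (𝓞 ℚ), (primesEquiv w : ℕ) = 107 →
      Nat.card (nsmulAddMonoidHom 5 : (F.baseChange (w.adicCompletion ℚ)).toAffine.Point →+ _).ker = 1)
    (h2 : ∀ w : HeightOneSpectrum (𝓞 ℚ), (primesEquiv w : ℕ) = 2 →
      (∃ r : w.adicCompletion ℚ, algebraMap ℚ (w.adicCompletion ℚ) (-(W.c₄ / W.c₆)) =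
          r ^ 2 * algebraMap ℚ (w.adicCompletion ℚ) (-(F.c₄ / F.c₆))) ∧
        (∀ ζ : w.adicCompletion ℚ, ζ ^ 5 = 1 → ζ = 1))
    (h59 : ∀ w : HeightOneSpectrum (𝓞 ℚ), (primesEquiv w : ℕ) = 59 →
      (∃ r : w.adicCompletion ℚ, algebraMap ℚ (w.adicCompletion ℚ) (-(W.c₄ / W.c₆)) =
          r ^ 2 * algebraMap ℚ (w.adicCompletion ℚ) (-(F.c₄ / F.c₆))) ∧
        (∀ ζ : w.adicCompletion ℚ, ζ ^ 5 = 1 → ζ = 1)) :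
    BSDp W 5 := by
  have hc4 : W.c₄ = (8384965557505 : ℚ) := by
    subst hWeq; norm_num [WeierstrassCurve.c₄, WeierstrassCurve.b₂, WeierstrassCurve.b₄]
  have hc6 : W.c₆ = (24280181264701817983 : ℚ) := by
    subst hWeq; norm_num [WeierstrassCurve.c₆, WeierstrassCurve.b₂, WeierstrassCurve.b₄, WeierstrassCurve.b₆]
  have hc4F : F.c₄ = (9757290625 : ℚ) := by
    subst hFeq; norm_num [WeierstrassCurve.c₄, WeierstrassCurve.b₂, WeierstrassCurve.b₄]
  have hc6F : F.c₆ = (-915917769490625 : ℚ) := by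
    subst hFeq; norm_num [WeierstrassCurve.c₆, WeierstrassCurve.b₂, WeierstrassCurve.b₄, WeierstrassCurve.b₆]
  obtain ⟨θ, hθ⟩ := fiveCongruent_of_hesseCertificate hF13 W F (-2944975 : ℚ) 1
    (145833440533279195958083584 : ℚ) (by norm_num)
    (by rw [hc4, hc6, hc4F, eval_hesseC4]; norm_num) (by rw [hc4, hc6, hc6F, eval_hesseC6]; norm_num)
  exact bsdp_x6r0vis_492414f1_5_of_congr hCT hW hGZK hmod hU hU2 hWeq hFeq hr0 hq hv θ hθ hrank h5 h3 h13 h107 h2 h59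

end Summit.BirchSwinnertonDyer.Rank1Residual.Supersingular

end
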